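import Mathlib
import HarnessLib
import Summits.HubbardSuperconductivity.HubbardSuperconductivity.Theorems.KLProgrammeC4aPPKernelMidRows

/-!
# Route `KLProgramme` — crux C4a, S3 brick (B4) «(B4)-UMK1», «(U1)-FARS-ROWS» part 1: the SMOOTH-FLOOR FAR PIECE `A_s(e,u) = P(e,u)·κ(r(e,u))`,
# `r = m̃ₑ/(m̃ₑ+m̃ᵤ)`, `m̃(x) = √(x²+lo²)` — partner derivatives, `C²`, support, the rows `hKd hK2d hK0 hK1 hK2 hsupp hKc hKs1` of `foldBox_law_rows'`

Cell `gate-hubbard-kl`, seat hubbard-kl-k3c3-p1 (g17; row «δμ-flow with klAngularMean constant piece»).  Located consistency point «(U1)-ONE-PARTITION» (KL STATUS 09:06Z):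
the bubble bound summed over the pieces of `P = A_s + swap A_s + M_s` (`ppTrueKernel_eq_farS_add_swap_add_midS`, p704596) needs the far-piece rows for the SAME
(smooth) ratio as the comparable-levels piece `M_s` (whose rows are `…C4aPPKernelMid*`, today); the max-floor family `ppFamilyKernel` (g16, parts 1–12) splits `P`
with a different ratio.  This file = the analogue of `…C4aPPKernelFamily` / `…FamilySecond` / `…FamilyRows` §hK* for `ppFarKernelS β Λ κ lo`:
* §1 `hasDerivAt_ppFarKernelS_u` (`A′ = ∂ᵤP·κ(r) + P·κ′(r)·r′`), `hasDerivAt_ppFarKernelSD1_u` (`A″`), `deriv_/iteratedDeriv_two_ppFarKernelS_u`, **`contDiff_two_ppFarKernelS_u`** (every `e`);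
* §2 support: `farS_dead_of_scale_le` (`m̃ᵤ ≤ q_s m̃ₑ ⟹ κ(r) = κ′(r) = κ″(r) = 0`, `q_s = (1−t₁)/t₁`), `farS_alive_scales` (else `q_s|e| < |u|` and `lo < |u|`);
* §3 rows: **`abs_deriv_ppFarKernelS_le`** (`hK1`: `e ≠ 0 ⟹ |∂ᵤA| ≤ C₁ᴬ·(max |e| |u|)⁻²`, `C₁ᴬ = κ₀(64B₂+108B₁+145) + κ₁(12B₁+9)`),
  **`abs_iteratedDeriv_two_ppFarKernelS_le`** (`hK2`: `0 < e ⟹ ≤ C₂ᴬ·(max e |u|)⁻³`), **`deriv_ppFarKernelS_eq_zero_of_abs_le`** (`hsupp`: `|u| ≤ q_s·e`),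
  **`abs_deriv_ppFarKernelS_strip_le`** (`hKs1`: `|e| ≤ lo ⟹ ≤ (κ₀(128B₁+72)+8κ₁)·(max lo |u|)⁻²`), **`continuous_deriv_ppFarKernelS₂`** (`hKc`).
Parts 2–4: negative loop levels (`hKn1`, ρ-rows), flatness (`hflat`), bundle + one-calls.  Pure real analysis; nothing asserts (C), K3, the window or superconductivity.
References: BGM 2006 §2.4 (2.36) [cite: BenfattoGiulianiMastropietro2006]; FST II CPAM 51 (1998) §3 [cite: FeldmanSalmhoferTrubowitz1998].
-/

noncomputable section

namespace Summit.HubbardSuperconductivity.HubbardSuperconductivity.Theorems.C4a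

set_option linter.dupNamespace false -- summit = problem name (single-conjunct summit), D-0017

open Real Filter Set
open scoped Topology
open Literature.MathematicalPhysics.QuantumLattice Literature.Analysis.SpecialFunctions

/-! ## §1 Partner derivatives of the smooth far piece -/

section Derivs

variable {β Λ : ℝ} (hβ : 0 < β) (hΛ : 0 < Λ) {B₁ B₂ : ℝ} (hB₁ : ∀ x, |deriv salmhoferCutoff x| ≤ B₁) (hB₂ : ∀ x, |deriv (deriv salmhoferCutoff) x| ≤ B₂)
  {κ κ' κ'' : ℝ → ℝ} (hκ : ∀ t, HasDerivAt κ (κ' t) t) (hκ' : ∀ t, HasDerivAt κ' (κ'' t) t) (hκ''c : Continuous κ'')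
  {lo : ℝ} (hlo : 0 < lo)

include hβ hΛ hB₁ hκ hlo in
/-- **`A′ = ∂ᵤP·κ(r) + P·κ′(r)·r′`**, `r′ = −m̃ₑ(u/m̃ᵤ)/(m̃ₑ+m̃ᵤ)²`. [cite: BenfattoGiulianiMastropietro2006, §2.4 (2.36)] -/
theorem hasDerivAt_ppFarKernelS_u (e u : ℝ) :
    HasDerivAt (fun v : ℝ => ppFarKernelS β Λ κ lo e v)
      (ppTrueKernelDu β Λ e u * κ (ppSmoothRatio lo e u) +
        ppTrueKernel β Λ e u * (κ' (ppSmoothRatio lo e u) * (-(ppSmoothScale lo e * (u / ppSmoothScale lo u)) / (ppSmoothScale lo e + ppSmoothScale lo u) ^ 2))) u := by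
  unfold ppFarKernelS
  exact (hasDerivAt_ppTrueKernel_u hβ hΛ hB₁ e u).fun_mul ((hκ _).comp u (hasDerivAt_ppSmoothRatio_u hlo e u))

include hβ hΛ hB₁ hκ hlo in
/-- `deriv A(e,·) = A′`. [cite: BenfattoGiulianiMastropietro2006, §2.4 (2.36)] -/
theorem deriv_ppFarKernelS_u (e : ℝ) :
    deriv (fun v : ℝ => ppFarKernelS β Λ κ lo e v) = fun u =>
      ppTrueKernelDu β Λ e u * κ (ppSmoothRatio lo e u) +
        ppTrueKernel β Λ e u * (κ' (ppSmoothRatio lo e u) * (-(ppSmoothScale lo e * (u / ppSmoothScale lo u)) / (ppSmoothScale lo e + ppSmoothScale lo u) ^ 2)) :=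
  funext fun u => (hasDerivAt_ppFarKernelS_u hβ hΛ hB₁ hκ hlo e u).deriv

include hβ hΛ hB₁ hB₂ hκ hκ' hlo in
/-- **`A″ = ∂ᵤ²P·κ(r) + 2∂ᵤP·κ′(r)r′ + P·(κ″(r)r′² + κ′(r)r″)`.** [cite: BenfattoGiulianiMastropietro2006, §2.4 (2.36)] -/
theorem hasDerivAt_ppFarKernelSD1_u (e u : ℝ) :
    HasDerivAt (fun v : ℝ => ppTrueKernelDu β Λ e v * κ (ppSmoothRatio lo e v) +
        ppTrueKernel β Λ e v * (κ' (ppSmoothRatio lo e v) * (-(ppSmoothScale lo e * (v / ppSmoothScale lo v)) / (ppSmoothScale lo e + ppSmoothScale lo v) ^ 2)))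
      (ppTrueKernelDuu β Λ e u * κ (ppSmoothRatio lo e u) +
        2 * ppTrueKernelDu β Λ e u * (κ' (ppSmoothRatio lo e u) * (-(ppSmoothScale lo e * (u / ppSmoothScale lo u)) / (ppSmoothScale lo e + ppSmoothScale lo u) ^ 2)) +
        ppTrueKernel β Λ e u *
          (κ'' (ppSmoothRatio lo e u) * (-(ppSmoothScale lo e * (u / ppSmoothScale lo u)) / (ppSmoothScale lo e + ppSmoothScale lo u) ^ 2) ^ 2 +
            κ' (ppSmoothRatio lo e u) *
              (-(ppSmoothScale lo e * ((lo ^ 2 / ppSmoothScale lo u ^ 3) * (ppSmoothScale lo e + ppSmoothScale lo u) - 2 * (u / ppSmoothScale lo u) ^ 2)) /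
                (ppSmoothScale lo e + ppSmoothScale lo u) ^ 3))) u := by
  have hP := hasDerivAt_ppTrueKernel_u hβ hΛ hB₁ e u
  have hP' := hasDerivAt_ppTrueKernelDu_u hβ hΛ hB₁ hB₂ e u
  have hr := hasDerivAt_ppSmoothRatio_u hlo e u
  have hr' := hasDerivAt_ppSmoothRatioD1_u hlo e u
  have hk : HasDerivAt (fun v : ℝ => κ (ppSmoothRatio lo e v)) (κ' (ppSmoothRatio lo e u) *
      (-(ppSmoothScale lo e * (u / ppSmoothScale lo u)) / (ppSmoothScale lo e + ppSmoothScale lo u) ^ 2)) u := (hκ _).comp u hr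
  have hk' : HasDerivAt (fun v : ℝ => κ' (ppSmoothRatio lo e v)) (κ'' (ppSmoothRatio lo e u) *
      (-(ppSmoothScale lo e * (u / ppSmoothScale lo u)) / (ppSmoothScale lo e + ppSmoothScale lo u) ^ 2)) u := (hκ' _).comp u hr
  have h := (hP'.fun_mul hk).fun_add (hP.fun_mul (hk'.fun_mul hr'))
  refine h.congr_deriv ?_
  ring

include hβ hΛ hB₁ hB₂ hκ hκ' hlo in
/-- `iteratedDeriv 2 A(e,·) = A″`. [cite: BenfattoGiulianiMastropietro2006, §2.4 (2.36)] -/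
theorem iteratedDeriv_two_ppFarKernelS_u (e u : ℝ) :
    iteratedDeriv 2 (fun v : ℝ => ppFarKernelS β Λ κ lo e v) u =
      ppTrueKernelDuu β Λ e u * κ (ppSmoothRatio lo e u) +
        2 * ppTrueKernelDu β Λ e u * (κ' (ppSmoothRatio lo e u) * (-(ppSmoothScale lo e * (u / ppSmoothScale lo u)) / (ppSmoothScale lo e + ppSmoothScale lo u) ^ 2)) +
        ppTrueKernel β Λ e u *
          (κ'' (ppSmoothRatio lo e u) * (-(ppSmoothScale lo e * (u / ppSmoothScale lo u)) / (ppSmoothScale lo e + ppSmoothScale lo u) ^ 2) ^ 2 +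
            κ' (ppSmoothRatio lo e u) *
              (-(ppSmoothScale lo e * ((lo ^ 2 / ppSmoothScale lo u ^ 3) * (ppSmoothScale lo e + ppSmoothScale lo u) - 2 * (u / ppSmoothScale lo u) ^ 2)) /
                (ppSmoothScale lo e + ppSmoothScale lo u) ^ 3)) := by
  rw [iteratedDeriv_succ, iteratedDeriv_one, deriv_ppFarKernelS_u hβ hΛ hB₁ hκ hlo e]
  exact (hasDerivAt_ppFarKernelSD1_u hβ hΛ hB₁ hB₂ hκ hκ' hlo e u).deriv

include hβ hΛ hB₁ hB₂ hκ hκ' hκ''c hlo in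
/-- **`u ↦ A(e,u)` is `C²`** at every loop level (smooth floor: no kink, no singularity). [cite: BenfattoGiulianiMastropietro2006, §2.4 (2.36)] -/
theorem contDiff_two_ppFarKernelS_u (e : ℝ) : ContDiff ℝ 2 (fun v : ℝ => ppFarKernelS β Λ κ lo e v) := by
  unfold ppFarKernelS
  exact (contDiff_two_ppTrueKernel_u hβ hΛ hB₁ hB₂ e).mul ((contDiff_two_of_hasDerivAt₂ hκ hκ' hκ''c).comp (contDiff_ppSmoothRatio hlo e))

end Derivs

/-! ## §2 Support: dead unless the partner is `q_s×` coarser in the floored scales -/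

section Support

variable {κ κ' κ'' : ℝ → ℝ} {t₁ : ℝ} (ht₀ : 0 < t₁) (ht25 : t₁ ≤ 2 / 5)
  (hκs : ∀ t, t₁ ≤ t → κ t = 0) (hκ's : ∀ t, t₁ ≤ t → κ' t = 0) (hκ''s : ∀ t, t₁ ≤ t → κ'' t = 0) {lo : ℝ} (hlo : 0 < lo)

include ht₀ hκs hκ's hκ''s hlo in
/-- **Dead zone**: `m̃ᵤ ≤ ((1−t₁)/t₁)·m̃ₑ ⟹ r ≥ t₁ ⟹ κ(r) = κ′(r) = κ″(r) = 0`. [folklore] -/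
theorem farS_dead_of_scale_le {e u : ℝ} (hu : ppSmoothScale lo u ≤ (1 - t₁) / t₁ * ppSmoothScale lo e) :
    κ (ppSmoothRatio lo e u) = 0 ∧ κ' (ppSmoothRatio lo e u) = 0 ∧ κ'' (ppSmoothRatio lo e u) = 0 := by
  have h1 := ppSmoothScale_pos hlo e
  have h2 := ppSmoothScale_pos hlo u
  have hr : t₁ ≤ ppSmoothRatio lo e u := by
    unfold ppSmoothRatio
    rw [le_div_iff₀ (by positivity)]
    have h3 : t₁ * ppSmoothScale lo u ≤ (1 - t₁) * ppSmoothScale lo e := by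
      have := mul_le_mul_of_nonneg_left hu ht₀.le
      rwa [← mul_assoc, mul_div_cancel₀ _ ht₀.ne'] at this
    linarith
  exact ⟨hκs _ hr, hκ's _ hr, hκ''s _ hr⟩

include ht₀ ht25 in
/-- **Alive zone scales**: `((1−t₁)/t₁)·m̃ₑ < m̃ᵤ` ⟹ `|e| < |u|`, `lo < |u|`, `m̃ₑ ≤ m̃ᵤ` (`(1−t₁)/t₁ ≥ 3/2`, `0 < lo`). [folklore] -/
theorem farS_alive_scales (hlo : 0 < lo) {e u : ℝ} (hu : (1 - t₁) / t₁ * ppSmoothScale lo e < ppSmoothScale lo u) :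
    |e| < |u| ∧ lo < |u| ∧ ppSmoothScale lo e ≤ ppSmoothScale lo u := by
  have hqs : 3 / 2 ≤ (1 - t₁) / t₁ := by rw [le_div_iff₀ ht₀]; linarith
  have h1 : 0 ≤ ppSmoothScale lo e := (ppSmoothScale_pos hlo e).le
  have hlt : 3 / 2 * ppSmoothScale lo e < ppSmoothScale lo u := lt_of_le_of_lt (by nlinarith) hu
  have hsq : (9 / 4) * (e ^ 2 + lo ^ 2) < u ^ 2 + lo ^ 2 := by
    have := mul_self_lt_mul_self (by positivity) hlt
    rw [← sq, ← sq, mul_pow, ppSmoothScale_sq, ppSmoothScale_sq] at this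
    nlinarith
  refine ⟨sq_lt_sq.1 (by nlinarith [sq_nonneg lo]), ?_, by nlinarith⟩
  have h := sq_lt_sq.1 (show lo ^ 2 < u ^ 2 by nlinarith [sq_nonneg e])
  rwa [abs_of_pos hlo] at h

end Support

/-! ## §3 The rows `hK1`, `hK2`, `hsupp`, `hKs1`, `hKc` -/

section Rows

variable {β Λ : ℝ} (hβ : 0 < β) (hΛ : 0 < Λ) {B₁ B₂ B₃ : ℝ} (hB₁ : ∀ x, |deriv salmhoferCutoff x| ≤ B₁) (hB₂ : ∀ x, |deriv (deriv salmhoferCutoff) x| ≤ B₂)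
  (hB₃ : ∀ x, |deriv (deriv (deriv salmhoferCutoff)) x| ≤ B₃)
  {κ κ' κ'' : ℝ → ℝ} (hκ : ∀ t, HasDerivAt κ (κ' t) t) (hκ' : ∀ t, HasDerivAt κ' (κ'' t) t)
  {κ₀ κ₁ κ₂ : ℝ} (hκb : ∀ t ∈ Icc 0 1, |κ t| ≤ κ₀) (hκ'b : ∀ t ∈ Icc 0 1, |κ' t| ≤ κ₁) (hκ''b : ∀ t ∈ Icc 0 1, |κ'' t| ≤ κ₂)
  {t₁ : ℝ} (ht₀ : 0 < t₁) (ht25 : t₁ ≤ 2 / 5)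
  (hκs : ∀ t, t₁ ≤ t → κ t = 0) (hκ's : ∀ t, t₁ ≤ t → κ' t = 0) (hκ''s : ∀ t, t₁ ≤ t → κ'' t = 0)
  {lo : ℝ} (hlo : 0 < lo) (hloΛ : lo ≤ Λ)

set_option maxHeartbeats 400000 in
include hβ hΛ hB₁ hB₂ hκ hκb hκ'b ht₀ ht25 hκs hκ's hκ''s hlo in
/-- **ROW `hK1`**: `e ≠ 0` ⟹ `|∂ᵤA(e,u)| ≤ (κ₀(64B₂+108B₁+145) + κ₁(12B₁+9))·(max |e| |u|)⁻¹²` for every `u` (alive ⟹ `|e| < |u|`: support `c = 1`).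
[cite: BenfattoGiulianiMastropietro2006, §2.4 (2.36)] -/
theorem abs_deriv_ppFarKernelS_le {e : ℝ} (he : e ≠ 0) (u : ℝ) :
    |deriv (fun v : ℝ => ppFarKernelS β Λ κ lo e v) u| ≤ (κ₀ * (64 * B₂ + 108 * B₁ + 145) + κ₁ * (12 * B₁ + 9)) * (max |e| |u|)⁻¹ ^ 2 := by
  have hB0 := salmhoferB₁_nonneg hB₁
  have hB20 : 0 ≤ B₂ := (abs_nonneg _).trans (hB₂ 0)
  have hκ₀ : 0 ≤ κ₀ := (abs_nonneg _).trans (hκb 0 (left_mem_Icc.2 zero_le_one))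
  have hκ₁ : 0 ≤ κ₁ := (abs_nonneg _).trans (hκ'b 0 (left_mem_Icc.2 zero_le_one))
  set M : ℝ := max |e| |u| with hM
  have hM0 : 0 < M := lt_max_of_lt_left (abs_pos.2 he)
  have hRHS : 0 ≤ (κ₀ * (64 * B₂ + 108 * B₁ + 145) + κ₁ * (12 * B₁ + 9)) * M⁻¹ ^ 2 := by positivity
  rw [(hasDerivAt_ppFarKernelS_u hβ hΛ hB₁ hκ hlo e u).deriv]
  rcases le_or_gt (ppSmoothScale lo u) ((1 - t₁) / t₁ * ppSmoothScale lo e) with hdead | halive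
  · obtain ⟨h0, h1, -⟩ := farS_dead_of_scale_le ht₀ hκs hκ's hκ''s hlo hdead
    have hz : ppTrueKernelDu β Λ e u * κ (ppSmoothRatio lo e u) +
        ppTrueKernel β Λ e u * (κ' (ppSmoothRatio lo e u) * (-(ppSmoothScale lo e * (u / ppSmoothScale lo u)) / (ppSmoothScale lo e + ppSmoothScale lo u) ^ 2)) = 0 := by
      rw [h0, h1]; ring
    rw [hz, abs_zero]; exact hRHS
  · obtain ⟨heu, -, -⟩ := farS_alive_scales ht₀ ht25 hlo halive
    have hr := ppSmoothRatio_mem_Ioo hlo e u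
    have hk : |κ (ppSmoothRatio lo e u)| ≤ κ₀ := hκb _ ⟨hr.1.le, hr.2.le⟩
    have hk' : |κ' (ppSmoothRatio lo e u)| ≤ κ₁ := hκ'b _ ⟨hr.1.le, hr.2.le⟩
    have hsupp1 : (1 : ℝ) * |e| ≤ |u| := by rw [one_mul]; exact heu.le
    have hP' := abs_ppTrueKernelDu_le_inv_max_sq_abs hβ hΛ hB₁ hB₂ (c := 1) one_pos le_rfl he hsupp1
    have hP := abs_ppTrueKernel_le_inv_max_abs hβ hΛ hB₁ he u
    have hr' : |-(ppSmoothScale lo e * (u / ppSmoothScale lo u)) / (ppSmoothScale lo e + ppSmoothScale lo u) ^ 2| ≤ M⁻¹ :=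
      (abs_ppSmoothRatioD1_le hlo e u).trans (inv_ppSmoothScale_add_le_inv_max hlo he u)
    have hA : |ppTrueKernelDu β Λ e u * κ (ppSmoothRatio lo e u)| ≤ (64 * B₂ + 96 * B₁ + 136 + (12 * B₁ + 9) / 1) * M⁻¹ ^ 2 * κ₀ := by
      rw [abs_mul]; exact mul_le_mul hP' hk (abs_nonneg _) (by positivity)
    have hB : |ppTrueKernel β Λ e u * (κ' (ppSmoothRatio lo e u) * (-(ppSmoothScale lo e * (u / ppSmoothScale lo u)) / (ppSmoothScale lo e + ppSmoothScale lo u) ^ 2))| ≤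
        (12 * B₁ + 9) * M⁻¹ * (κ₁ * M⁻¹) := by
      rw [abs_mul, abs_mul]; exact mul_le_mul hP (mul_le_mul hk' hr' (abs_nonneg _) hκ₁) (by positivity) (by positivity)
    refine ((abs_add_le _ _).trans (add_le_add hA hB)).trans (le_of_eq ?_)
    ring

set_option maxHeartbeats 400000 in
include hβ hΛ hB₁ hB₂ hB₃ hκ hκ' hκb hκ'b hκ''b ht₀ ht25 hκs hκ's hκ''s hlo in
/-- **ROW `hK2`**: `0 < e` ⟹ `|∂ᵤ²A(e,u)| ≤ C₂ᴬ·(max e |u|)⁻¹³`, `C₂ᴬ = κ₀(256B₃+800B₂+2592B₁+1630) + 2κ₁(64B₂+108B₁+145) + (12B₁+9)(κ₂+3κ₁)`.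
[cite: BenfattoGiulianiMastropietro2006, §2.4 (2.36)] -/
theorem abs_iteratedDeriv_two_ppFarKernelS_le {e : ℝ} (he : 0 < e) (u : ℝ) :
    |iteratedDeriv 2 (fun v : ℝ => ppFarKernelS β Λ κ lo e v) u| ≤
      (κ₀ * (256 * B₃ + 800 * B₂ + 2592 * B₁ + 1630) + 2 * κ₁ * (64 * B₂ + 108 * B₁ + 145) + (12 * B₁ + 9) * (κ₂ + 3 * κ₁)) * (max e |u|)⁻¹ ^ 3 := by
  have hB0 := salmhoferB₁_nonneg hB₁
  have hB20 : 0 ≤ B₂ := (abs_nonneg _).trans (hB₂ 0)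
  have hB30 : 0 ≤ B₃ := (abs_nonneg _).trans (hB₃ 0)
  have hκ₀ : 0 ≤ κ₀ := (abs_nonneg _).trans (hκb 0 (left_mem_Icc.2 zero_le_one))
  have hκ₁ : 0 ≤ κ₁ := (abs_nonneg _).trans (hκ'b 0 (left_mem_Icc.2 zero_le_one))
  have hκ₂ : 0 ≤ κ₂ := (abs_nonneg _).trans (hκ''b 0 (left_mem_Icc.2 zero_le_one))
  set M : ℝ := max e |u| with hM
  have hM0 : 0 < M := he.trans_le (le_max_left _ _)
  have hRHS : 0 ≤ (κ₀ * (256 * B₃ + 800 * B₂ + 2592 * B₁ + 1630) + 2 * κ₁ * (64 * B₂ + 108 * B₁ + 145) + (12 * B₁ + 9) * (κ₂ + 3 * κ₁)) * M⁻¹ ^ 3 := by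
    positivity
  rw [iteratedDeriv_two_ppFarKernelS_u hβ hΛ hB₁ hB₂ hκ hκ' hlo e u]
  rcases le_or_gt (ppSmoothScale lo u) ((1 - t₁) / t₁ * ppSmoothScale lo e) with hdead | halive
  · obtain ⟨h0, h1, h2⟩ := farS_dead_of_scale_le ht₀ hκs hκ's hκ''s hlo hdead
    have hz : ppTrueKernelDuu β Λ e u * κ (ppSmoothRatio lo e u) +
        2 * ppTrueKernelDu β Λ e u * (κ' (ppSmoothRatio lo e u) * (-(ppSmoothScale lo e * (u / ppSmoothScale lo u)) / (ppSmoothScale lo e + ppSmoothScale lo u) ^ 2)) +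
        ppTrueKernel β Λ e u *
          (κ'' (ppSmoothRatio lo e u) * (-(ppSmoothScale lo e * (u / ppSmoothScale lo u)) / (ppSmoothScale lo e + ppSmoothScale lo u) ^ 2) ^ 2 +
            κ' (ppSmoothRatio lo e u) *
              (-(ppSmoothScale lo e * ((lo ^ 2 / ppSmoothScale lo u ^ 3) * (ppSmoothScale lo e + ppSmoothScale lo u) - 2 * (u / ppSmoothScale lo u) ^ 2)) /
                (ppSmoothScale lo e + ppSmoothScale lo u) ^ 3)) = 0 := by
      rw [h0, h1, h2]; ring
    rw [hz, abs_zero]; exact hRHS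
  · obtain ⟨heu, -, hSS⟩ := farS_alive_scales ht₀ ht25 hlo halive
    rw [abs_of_pos he] at heu
    have hr := ppSmoothRatio_mem_Ioo hlo e u
    have hIcc : ppSmoothRatio lo e u ∈ Icc (0 : ℝ) 1 := ⟨hr.1.le, hr.2.le⟩
    have hk := hκb _ hIcc
    have hk' := hκ'b _ hIcc
    have hk'' := hκ''b _ hIcc
    have hsupp1 : (1 : ℝ) * e ≤ |u| := by rw [one_mul]; exact heu.le
    have hP'' := abs_ppTrueKernelDuu_le_inv_max_cube hβ hΛ hB₁ hB₂ hB₃ (c := 1) one_pos le_rfl he hsupp1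
    have hP' := abs_ppTrueKernelDu_le_inv_max_sq hβ hΛ hB₁ hB₂ (c := 1) one_pos le_rfl he hsupp1
    have hP := abs_ppTrueKernel_le_inv_max hβ hΛ hB₁ he u
    have hSM : 1 / (ppSmoothScale lo e + ppSmoothScale lo u) ≤ M⁻¹ := by
      have := inv_ppSmoothScale_add_le_inv_max hlo he.ne' u
      rwa [abs_of_pos he] at this
    have hr' : |-(ppSmoothScale lo e * (u / ppSmoothScale lo u)) / (ppSmoothScale lo e + ppSmoothScale lo u) ^ 2| ≤ M⁻¹ :=
      (abs_ppSmoothRatioD1_le hlo e u).trans hSM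
    have hr'' : |-(ppSmoothScale lo e * ((lo ^ 2 / ppSmoothScale lo u ^ 3) * (ppSmoothScale lo e + ppSmoothScale lo u) - 2 * (u / ppSmoothScale lo u) ^ 2)) /
        (ppSmoothScale lo e + ppSmoothScale lo u) ^ 3| ≤ 3 * M⁻¹ ^ 2 := by
      refine (abs_ppSmoothRatioD2_le_of_scale hlo (q := 1) (by rw [one_mul]; exact hSS)).trans ?_
      have hS0 : 0 ≤ 1 / (ppSmoothScale lo e + ppSmoothScale lo u) := by
        have := ppSmoothScale_pos hlo e; have := ppSmoothScale_pos hlo u; positivity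
      calc ((1 : ℝ) + 2) / (ppSmoothScale lo e + ppSmoothScale lo u) ^ 2 = 3 * (1 / (ppSmoothScale lo e + ppSmoothScale lo u)) ^ 2 := by
            rw [one_div_pow]; ring
        _ ≤ 3 * M⁻¹ ^ 2 := mul_le_mul_of_nonneg_left (pow_le_pow_left₀ hS0 hSM 2) (by norm_num)
    have hA : |ppTrueKernelDuu β Λ e u * κ (ppSmoothRatio lo e u)| ≤
        (256 * B₃ + 768 * B₂ + 2496 * B₁ + 1528 + (32 * B₂ + 48 * B₁ + 66) / 1 ^ 2 + (48 * B₁ + 36) / 1) * M⁻¹ ^ 3 * κ₀ := by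
      rw [abs_mul]; exact mul_le_mul hP'' hk (abs_nonneg _) (by positivity)
    have hB : |2 * ppTrueKernelDu β Λ e u * (κ' (ppSmoothRatio lo e u) * (-(ppSmoothScale lo e * (u / ppSmoothScale lo u)) / (ppSmoothScale lo e + ppSmoothScale lo u) ^ 2))| ≤
        2 * ((64 * B₂ + 96 * B₁ + 136 + (12 * B₁ + 9) / 1) * M⁻¹ ^ 2) * (κ₁ * M⁻¹) := by
      rw [abs_mul, abs_mul, abs_mul, abs_of_pos (by norm_num : (0 : ℝ) < 2)]
      exact mul_le_mul (mul_le_mul_of_nonneg_left hP' (by norm_num)) (mul_le_mul hk' hr' (abs_nonneg _) hκ₁) (by positivity) (by positivity)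
    have hC : |ppTrueKernel β Λ e u *
        (κ'' (ppSmoothRatio lo e u) * (-(ppSmoothScale lo e * (u / ppSmoothScale lo u)) / (ppSmoothScale lo e + ppSmoothScale lo u) ^ 2) ^ 2 +
          κ' (ppSmoothRatio lo e u) *
            (-(ppSmoothScale lo e * ((lo ^ 2 / ppSmoothScale lo u ^ 3) * (ppSmoothScale lo e + ppSmoothScale lo u) - 2 * (u / ppSmoothScale lo u) ^ 2)) /
              (ppSmoothScale lo e + ppSmoothScale lo u) ^ 3))| ≤ (12 * B₁ + 9) * M⁻¹ * (κ₂ * M⁻¹ ^ 2 + κ₁ * (3 * M⁻¹ ^ 2)) := by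
      rw [abs_mul]
      refine mul_le_mul hP ((abs_add_le _ _).trans (add_le_add ?_ ?_)) (abs_nonneg _) (by positivity)
      · rw [abs_mul, abs_pow]; exact mul_le_mul hk'' (pow_le_pow_left₀ (abs_nonneg _) hr' 2) (by positivity) hκ₂
      · rw [abs_mul]; exact mul_le_mul hk' hr'' (abs_nonneg _) hκ₁
    refine ((abs_add_le _ _).trans (add_le_add ((abs_add_le _ _).trans (add_le_add hA hB)) hC)).trans (le_of_eq ?_)
    ring

include hβ hΛ hB₁ hκ ht₀ ht25 hκs hκ's hκ''s hlo in
/-- **ROW `hsupp`**: `0 < e`, `|u| ≤ ((1−t₁)/t₁)·e` ⟹ `∂ᵤA(e,u) = 0` (and the value vanishes). [cite: FeldmanSalmhoferTrubowitz1998, §3] -/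
theorem deriv_ppFarKernelS_eq_zero_of_abs_le {e u : ℝ} (he : 0 < e) (hu : |u| ≤ (1 - t₁) / t₁ * e) :
    deriv (fun v : ℝ => ppFarKernelS β Λ κ lo e v) u = 0 := by
  have hqs : 1 ≤ (1 - t₁) / t₁ := by rw [le_div_iff₀ ht₀]; linarith
  have hscale : ppSmoothScale lo u ≤ (1 - t₁) / t₁ * ppSmoothScale lo e := ppSmoothScale_le_mul hqs (by rwa [abs_of_pos he])
  obtain ⟨h0, h1, -⟩ := farS_dead_of_scale_le ht₀ hκs hκ's hκ''s hlo hscale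
  rw [(hasDerivAt_ppFarKernelS_u hβ hΛ hB₁ hκ hlo e u).deriv, h0, h1]; ring

set_option maxHeartbeats 400000 in
include hβ hΛ hB₁ hκ hκb hκ'b hlo hloΛ in
/-- **ROW `hKs1` (loop levels within `lo` of the Fermi level)**: `|e| ≤ lo` ⟹ `|∂ᵤA(e,u)| ≤ (κ₀(128B₁+72) + 8κ₁)·(max lo |u|)⁻¹²` for every `u`
(the strip envelopes of `…C4aPPKernelStripEnvelope` / `…Family` and `|r′| ≤ 1/(m̃ₑ+m̃ᵤ) ≤ (max lo |u|)⁻¹`). [cite: BenfattoGiulianiMastropietro2006, §2.4 (2.36)] -/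
theorem abs_deriv_ppFarKernelS_strip_le {e : ℝ} (he : |e| ≤ lo) (u : ℝ) :
    |deriv (fun v : ℝ => ppFarKernelS β Λ κ lo e v) u| ≤ (κ₀ * (128 * B₁ + 72) + 8 * κ₁) * (max lo |u|)⁻¹ ^ 2 := by
  have hB0 := salmhoferB₁_nonneg hB₁
  have hκ₀ : 0 ≤ κ₀ := (abs_nonneg _).trans (hκb 0 (left_mem_Icc.2 zero_le_one))
  have hκ₁ : 0 ≤ κ₁ := (abs_nonneg _).trans (hκ'b 0 (left_mem_Icc.2 zero_le_one))
  have heΛ : |e| ≤ Λ := he.trans hloΛ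
  set M : ℝ := max lo |u| with hM
  have hM0 : 0 < M := hlo.trans_le (le_max_left _ _)
  have hMΛ : M ≤ max Λ |u| := max_le_max hloΛ le_rfl
  have hinv1 : (max Λ |u|)⁻¹ ≤ M⁻¹ := inv_anti₀ hM0 hMΛ
  have hinv2 : (max Λ |u|)⁻¹ ^ 2 ≤ M⁻¹ ^ 2 := pow_le_pow_left₀ (inv_nonneg.2 (hM0.le.trans hMΛ)) hinv1 2
  rw [(hasDerivAt_ppFarKernelS_u hβ hΛ hB₁ hκ hlo e u).deriv]
  have hr := ppSmoothRatio_mem_Ioo hlo e u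
  have hk : |κ (ppSmoothRatio lo e u)| ≤ κ₀ := hκb _ ⟨hr.1.le, hr.2.le⟩
  have hk' : |κ' (ppSmoothRatio lo e u)| ≤ κ₁ := hκ'b _ ⟨hr.1.le, hr.2.le⟩
  have hP' := (abs_ppTrueKernelDu_strip_le_inv_max_sq hβ hΛ hB₁ heΛ u).trans (mul_le_mul_of_nonneg_left hinv2 (by positivity))
  have hP := (abs_ppTrueKernel_strip_le_inv_max hβ hΛ heΛ u).trans (mul_le_mul_of_nonneg_left hinv1 (by norm_num))
  have hr' : |-(ppSmoothScale lo e * (u / ppSmoothScale lo u)) / (ppSmoothScale lo e + ppSmoothScale lo u) ^ 2| ≤ M⁻¹ := by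
    refine (abs_ppSmoothRatioD1_le hlo e u).trans ?_
    have h1 := le_ppSmoothScale hlo.le e
    have h2 := abs_le_ppSmoothScale lo u
    rw [one_div]
    refine inv_anti₀ hM0 (max_le (by linarith [ppSmoothScale_pos hlo u]) (by linarith [ppSmoothScale_pos hlo e]))
  have hA : |ppTrueKernelDu β Λ e u * κ (ppSmoothRatio lo e u)| ≤ (128 * B₁ + 72) * M⁻¹ ^ 2 * κ₀ := by
    rw [abs_mul]; exact mul_le_mul hP' hk (abs_nonneg _) (by positivity)
  have hB : |ppTrueKernel β Λ e u * (κ' (ppSmoothRatio lo e u) * (-(ppSmoothScale lo e * (u / ppSmoothScale lo u)) / (ppSmoothScale lo e + ppSmoothScale lo u) ^ 2))| ≤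
      8 * M⁻¹ * (κ₁ * M⁻¹) := by
    rw [abs_mul, abs_mul]; exact mul_le_mul hP (mul_le_mul hk' hr' (abs_nonneg _) hκ₁) (by positivity) (by positivity)
  refine ((abs_add_le _ _).trans (add_le_add hA hB)).trans (le_of_eq ?_)
  ring

include hβ hΛ hB₁ hκ hlo in
/-- **ROW `hKc`**: `(e,u) ↦ ∂ᵤA(e,u)` is jointly continuous on ℝ². [cite: BenfattoGiulianiMastropietro2006, §2.4 (2.36)] -/
theorem continuous_deriv_ppFarKernelS₂ (hκ'c : Continuous κ') : Continuous fun p : ℝ × ℝ => deriv (fun v : ℝ => ppFarKernelS β Λ κ lo p.1 v) p.2 := by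
  have hd : ∀ p : ℝ × ℝ, deriv (fun v : ℝ => ppFarKernelS β Λ κ lo p.1 v) p.2 =
      ppTrueKernelDu β Λ p.1 p.2 * κ (ppSmoothRatio lo p.1 p.2) +
        ppTrueKernel β Λ p.1 p.2 * (κ' (ppSmoothRatio lo p.1 p.2) *
          (-(ppSmoothScale lo p.1 * (p.2 / ppSmoothScale lo p.2)) / (ppSmoothScale lo p.1 + ppSmoothScale lo p.2) ^ 2)) :=
    fun p => (hasDerivAt_ppFarKernelS_u hβ hΛ hB₁ hκ hlo p.1 p.2).deriv
  simp_rw [hd]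
  have hκc : Continuous κ := continuous_iff_continuousAt.2 fun t => (hκ t).continuousAt
  have hr : Continuous fun p : ℝ × ℝ => ppSmoothRatio lo p.1 p.2 := continuous_ppSmoothRatio₂ hlo
  have hP : Continuous fun p : ℝ × ℝ => ppTrueKernel β Λ p.1 p.2 := continuous_ppTrueKernel_comp hβ Λ continuous_fst continuous_snd
  have hP' : Continuous fun p : ℝ × ℝ => ppTrueKernelDu β Λ p.1 p.2 := continuous_ppTrueKernelDu_comp hβ hΛ hB₁ continuous_fst continuous_snd
  have hSe : Continuous fun p : ℝ × ℝ => ppSmoothScale lo p.1 := (contDiff_ppSmoothScale hlo (n := 0)).continuous.comp continuous_fst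
  have hSu : Continuous fun p : ℝ × ℝ => ppSmoothScale lo p.2 := (contDiff_ppSmoothScale hlo (n := 0)).continuous.comp continuous_snd
  have hr' : Continuous fun p : ℝ × ℝ => -(ppSmoothScale lo p.1 * (p.2 / ppSmoothScale lo p.2)) / (ppSmoothScale lo p.1 + ppSmoothScale lo p.2) ^ 2 := by
    refine Continuous.div ((hSe.mul (continuous_snd.div hSu fun p => (ppSmoothScale_pos hlo _).ne')).neg) ((hSe.add hSu).pow 2) fun p => ?_
    have := ppSmoothScale_pos hlo p.1; have := ppSmoothScale_pos hlo p.2; positivity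
  exact (hP'.mul (hκc.comp hr)).add (hP.mul ((hκ'c.comp hr).mul hr'))

end Rows

end Summit.HubbardSuperconductivity.HubbardSuperconductivity.Theorems.C4a

end
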